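import Summits.BirchSwinnertonDyer.BirchSwinnertonDyer.Theorems.Rank2ObservatoryPadicAtlasR2A00
import Summits.BirchSwinnertonDyer.BirchSwinnertonDyer.Theorems.Rank2ObservatoryPadicAtlasR2A01
import Summits.BirchSwinnertonDyer.BirchSwinnertonDyer.Theorems.Rank2ObservatoryPadicAtlasR2A02
import Summits.BirchSwinnertonDyer.BirchSwinnertonDyer.Theorems.Rank2ObservatoryPadicAtlasR2A03
import Summits.BirchSwinnertonDyer.BirchSwinnertonDyer.Theorems.Rank2ObservatoryPadicAtlasR2A04
import Summits.BirchSwinnertonDyer.BirchSwinnertonDyer.Theorems.Rank2ObservatoryPadicAtlasR2A05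
import Summits.BirchSwinnertonDyer.BirchSwinnertonDyer.Theorems.Rank2ObservatoryPadicAtlasR2A06
import Summits.BirchSwinnertonDyer.BirchSwinnertonDyer.Theorems.Rank2ObservatoryPadicAtlasR2A07
import Summits.BirchSwinnertonDyer.BirchSwinnertonDyer.Theorems.Rank2ObservatoryPadicAtlasR2A08
import Summits.BirchSwinnertonDyer.BirchSwinnertonDyer.Theorems.Rank2ObservatoryPadicAtlasR2A09
import Summits.BirchSwinnertonDyer.BirchSwinnertonDyer.Theorems.Rank2ObservatoryPadicAtlasR2A11
import Summits.BirchSwinnertonDyer.BirchSwinnertonDyer.Theorems.Rank2ObservatoryRank2Rows00Complete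
import HarnessLib

/-!
# BirchSwinnertonDyer — rank ≥ 2 observatory: `p`-adic atlas of the rank-2 census — UNCONDITIONAL RANK
# for parts 00–09 and 11 (the census rank certificate `hlow` discharged in-tree)

HONEST FRAMING: per-curve certified theorems and census instruments; no claim on BSD in rank ≥ 2.

The twelve landed data parts `Rank2ObservatoryPadicAtlasR2A00 … R2A11` (396 curves of the rank-2 census
with conductor `N ≤ 4448`, 629 two-engine cells `(E, p)`, `p ∈ {5, 7, 11, 13}` good ordinary) state their
consequence `padicRow_of_mem_atlasR2ANN` under the census rank certificate
`hlow : 2 ≤ rank_ℤ E(ℚ)` as a NAMED HYPOTHESIS. This file discharges it for parts 00–09 and 11 (354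
curves; part 10, 42 curves, is treated identically in `Rank2ObservatoryPadicAtlasR2ARank10.lean`): the
rows of the atlas are rows
of the census chunk `rank2Rows00` VERBATIM — ONE kernel `decide` per table of the sublist relation
`(table.map AtlasCurve.row) <+ rank2Rows00` (derived `DecidableEq Rank2Row`; the generator emits the
curves in census order) — and `Rank2ObservatoryRank2Rows00Complete.lean` proves
`2 ≤ rank_ℤ E(ℚ)` for EVERY row of that chunk with no hypothesis (kernel certificates of two independent
listed points + Mordell–Weil in the tree). Consequences (`padicRowU_of_mem_atlasR2Amin` for the 332
curves of parts 00–09, whose models are globally minimal by `AtlasCurve.minCheck`, and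
`padicRowU_of_mem_atlasR2A11` for the 22 curves of part 11, minimal by the Kraus step `minCheck₂`): for
every listed cell `(E, p)`, GIVEN ONLY the named analytic inputs of the series — `hPRS` (Perrin-Riou–
Schneider, BMS Thm. 1.7), `hkato` (Kato, Thm. 17.4, all cyclotomic data), the newform `hf` — and the
symbol DATA `hint`/`htab` (the plus modular symbols of `f` are `p`-integral and the tabulated numerators
ARE `D·[u/p^{n+1}]⁺`, `D·[v/p^n]⁺` for a `p`-unit `D`; two-engine tables, `data/padic/symtab/` of the
cell folder): `rank_ℤ E(ℚ) = 2` EXACTLY, `ord_{T=0} L_p(E,T) = 2`, `Ш(E/ℚ)[p^∞]` finite, every canonical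
`p`-adic height pairing on `E` is non-degenerate (Schneider's conjecture at `(E, p)`), and
`corank_{ℤ_p} Sel_{p^∞}(E/ℚ) = 2`. The rank input is now a theorem of the tree, not a hypothesis.
No `sorry`, no new axioms, kernel `decide` only (no `native_decide`).

References: B. Mazur, J. Tate, J. Teitelbaum, Invent. Math. 84 (1986), §I.10–I.13; J. Balakrishnan,
J. S. Müller, W. Stein, Math. Comp. 85 (2016), Thm. 1.7; K. Kato, Astérisque 295 (2004), Thm. 17.4;
P. Schneider, Invent. Math. 79 (1985); J. Cremona, Algorithms for Modular Elliptic Curves (1997), Table 1,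
§3.5; J. Silverman, AEC (2009), VIII.6.7.
-/

-- single-conjunct summit: `Summit.BirchSwinnertonDyer.BirchSwinnertonDyer.…` repeats the name by design
set_option linter.dupNamespace false

namespace Summit.BirchSwinnertonDyer.BirchSwinnertonDyer.Rank2Observatory

open scoped MatrixGroups ModularForm
open CongruenceSubgroup Literature.NumberTheory.EllipticCurves
  Literature.NumberTheory.EllipticCurves.ModularForms WeierstrassCurve

/-- The atlas parts 00–09 concatenated (332 curves, globally minimal models by `AtlasCurve.minCheck`).
[cite: CremonaAlgorithms1997, Table 1] -/
noncomputable def atlasR2Amin : List AtlasCurve :=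
  atlasR2A00 ++ atlasR2A01 ++ atlasR2A02 ++ atlasR2A03 ++ atlasR2A04 ++ atlasR2A05 ++ atlasR2A06 ++
    atlasR2A07 ++ atlasR2A08 ++ atlasR2A09

/-- Every curve of `atlasR2Amin` passes `check` and `minCheck` (from the ten part certificates).
[folklore] -/
theorem atlasR2Amin_check : atlasR2Amin.all (fun C => C.check && C.minCheck) = true := by
  simp only [atlasR2Amin, List.all_append, Bool.and_eq_true, atlasR2A00_check, atlasR2A01_check,
    atlasR2A02_check, atlasR2A03_check, atlasR2A04_check, atlasR2A05_check, atlasR2A06_check,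
    atlasR2A07_check, atlasR2A08_check, atlasR2A09_check, and_self]

/-- `332` curves in parts 00–09. [folklore] -/
theorem atlasR2Amin_length : atlasR2Amin.length = 332 := by decide +kernel

/-- `22` curves in part 11. [folklore] -/
theorem atlasR2A11_length : atlasR2A11.length = 22 := by decide +kernel

/-- The rows of parts 00–09 form a sublist of the census chunk `rank2Rows00` (ONE kernel `decide`,
derived `DecidableEq Rank2Row`): the atlas rows ARE census rows, verbatim and in census order.
[cite: CremonaAlgorithms1997, Table 1] -/
theorem atlasR2Amin_sublist : (atlasR2Amin.map AtlasCurve.row).Sublist rank2Rows00 := by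
  decide +kernel

/-- The rows of part 11 form a sublist of the census chunk `rank2Rows00` (kernel `decide`).
[cite: CremonaAlgorithms1997, Table 1] -/
theorem atlasR2A11_sublist : (atlasR2A11.map AtlasCurve.row).Sublist rank2Rows00 := by
  decide +kernel

/-- Every row of parts 00–09 is a row of the census chunk `rank2Rows00`. [folklore] -/
theorem row_mem_rank2Rows00_of_mem_atlasR2Amin {C : AtlasCurve} (hC : C ∈ atlasR2Amin) :
    C.row ∈ rank2Rows00 :=
  atlasR2Amin_sublist.subset (List.mem_map_of_mem hC)

/-- Every row of part 11 is a row of the census chunk `rank2Rows00`. [folklore] -/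
theorem row_mem_rank2Rows00_of_mem_atlasR2A11 {C : AtlasCurve} (hC : C ∈ atlasR2A11) :
    C.row ∈ rank2Rows00 :=
  atlasR2A11_sublist.subset (List.mem_map_of_mem hC)

/-- Every row of parts 00–09 is a row of the census table `rank2Table`.
[cite: CremonaAlgorithms1997, Table 1] -/
theorem row_mem_rank2Table_of_mem_atlasR2Amin {C : AtlasCurve} (hC : C ∈ atlasR2Amin) :
    C.row ∈ rank2Table :=
  mem_rank2Table_of_mem_rank2Rows00 (row_mem_rank2Rows00_of_mem_atlasR2Amin hC)

/-- Every row of part 11 is a row of the census table `rank2Table`.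
[cite: CremonaAlgorithms1997, Table 1] -/
theorem row_mem_rank2Table_of_mem_atlasR2A11 {C : AtlasCurve} (hC : C ∈ atlasR2A11) :
    C.row ∈ rank2Table :=
  mem_rank2Table_of_mem_rank2Rows00 (row_mem_rank2Rows00_of_mem_atlasR2A11 hC)

/-- **`2 ≤ rank_ℤ E(ℚ)` for every curve of parts 00–09, with NO hypothesis** (chunk completeness
`two_le_mordellWeilRank_of_mem_rank2Rows00`). [cite: CremonaAlgorithms1997, §3.5]
[cite: SilvermanAEC2009, Thm. VIII.6.7] -/
theorem two_le_rank_of_mem_atlasR2Amin {C : AtlasCurve} (hC : C ∈ atlasR2Amin) :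
    2 ≤ C.row.curve.mordellWeilRank :=
  two_le_mordellWeilRank_of_mem_rank2Rows00 (row_mem_rank2Rows00_of_mem_atlasR2Amin hC)

/-- **`2 ≤ rank_ℤ E(ℚ)` for every curve of part 11, with NO hypothesis.**
[cite: CremonaAlgorithms1997, §3.5] [cite: SilvermanAEC2009, Thm. VIII.6.7] -/
theorem two_le_rank_of_mem_atlasR2A11 {C : AtlasCurve} (hC : C ∈ atlasR2A11) :
    2 ≤ C.row.curve.mordellWeilRank :=
  two_le_mordellWeilRank_of_mem_rank2Rows00 (row_mem_rank2Rows00_of_mem_atlasR2A11 hC)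

/-- Every curve of `atlasR2Amin` is elliptic. [folklore] -/
theorem isElliptic_of_mem_atlasR2Amin {C : AtlasCurve} (hC : C ∈ atlasR2Amin) :
    (C.e.baseChange ℚ).IsElliptic :=
  AtlasCurve.isElliptic (AtlasCurve.check_of_all atlasR2Amin_check hC).1

/-- Every curve of `atlasR2Amin` has a globally minimal integer model.
[cite: SilvermanAEC2009, VII.1 Remark 1.1] -/
theorem isGloballyMinimal_of_mem_atlasR2Amin {C : AtlasCurve} (hC : C ∈ atlasR2Amin) :
    (C.e.baseChange ℚ).IsGloballyMinimal :=
  AtlasCurve.isGloballyMinimal (AtlasCurve.check_of_all atlasR2Amin_check hC).2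

/-- The prime of every cell of `atlasR2Amin` is prime. [folklore] -/
theorem prime_of_mem_atlasR2Amin {C : AtlasCurve} (hC : C ∈ atlasR2Amin) {c : AtlasCell}
    (hc : c ∈ C.cells) : c.p.Prime :=
  AtlasCurve.prime_of_mem (AtlasCurve.check_of_all atlasR2Amin_check hC).1 hc

/-- **The `p`-adic row of every cell of parts 00–09 with the rank input PROVED** (`AtlasCurve.padicRow`
with `hlow := two_le_rank_of_mem_atlasR2Amin hC`; instances from `isElliptic_of_mem_atlasR2Amin`,
`isGloballyMinimal_of_mem_atlasR2Amin`, `prime_of_mem_atlasR2Amin`): GIVEN `hPRS`, `hkato`, the newform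
`hf` and the symbol DATA `hint`/`htab` only, `rank = 2`, `ord_{T=0} L_p = 2`, `Ш[p^∞]` finite,
Schneider non-degeneracy at `p`, `corank Sel_{p^∞} = 2`.
[cite: BalakrishnanMullerStein2015, Thm. 1.7] [cite: Kato2004Asterisque, Thm. 17.4 (p. 273)]
[cite: MazurTateTeitelbaum1986Invent, §I.10–I.13] -/
theorem padicRowU_of_mem_atlasR2Amin {C : AtlasCurve} (hC : C ∈ atlasR2Amin) {c : AtlasCell}
    (hc : c ∈ C.cells) [Fact c.p.Prime] [(C.e.baseChange ℚ).IsElliptic]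
    [(C.e.baseChange ℚ).IsGloballyMinimal] (hPRS : Schneider1985_order_charGenerator) {N : ℕ}
    [NeZero N] {f : CuspForm (Gamma0 N) 2} (hf : IsNewformOf (C.e.baseChange ℚ) f)
    (hkato : ∀ (κ : ZpExtension ℚ c.p) (γ : Field.absoluteGaloisGroup ℚ),
      kato_divisibility (C.e.baseChange ℚ) c.p (κ := κ) (γ := γ) (f := f))
    (D : ℚ) (hD : ‖(D : ℚ_[c.p])‖ = 1) (hint : ∀ x : ℚ, ‖(ratPlusSymbol f x : ℚ_[c.p])‖ ≤ 1)
    (htab : ∀ u : ℕ, u < c.p ^ (c.n + 1) → ¬ c.p ∣ u →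
      ratPlusSymbol f ((u : ℚ) / (c.p : ℚ) ^ (c.n + 1)) = (c.tabHi.getD u 0 : ℚ) / D ∧
      ratPlusSymbol f ((u : ℚ) / (c.p : ℚ) ^ c.n) = (c.tabLo.getD (u % c.p ^ c.n) 0 : ℚ) / D) :
    C.row.curve.mordellWeilRank = 2 ∧
      (padicLFunction f (unitRoot (C.e.baseChange ℚ) c.p : ℚ_[c.p])).order = 2 ∧
      Finite (AddCommGroup.primaryComponent (C.e.baseChange ℚ).sha c.p) ∧
      (∀ Dh : PAdicHeightData (C.e.baseChange ℚ) c.p, Dh.IsCanonical → SchneiderConjecture Dh) ∧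
      (C.e.baseChange ℚ).selmerCorank c.p = 2 :=
  AtlasCurve.padicRow (AtlasCurve.check_of_all atlasR2Amin_check hC).1 hc hPRS hf hkato
    (two_le_rank_of_mem_atlasR2Amin hC) D hD hint htab

/-- **The `p`-adic row of every cell of part 11 with the rank input PROVED** (as above; minimality of
the 22 models by the Kraus step `minCheck₂`, instances from `isElliptic_of_mem_atlasR2A11`,
`isGloballyMinimal_of_mem_atlasR2A11`, `prime_of_mem_atlasR2A11`).
[cite: BalakrishnanMullerStein2015, Thm. 1.7] [cite: Kato2004Asterisque, Thm. 17.4 (p. 273)]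
[cite: MazurTateTeitelbaum1986Invent, §I.10–I.13] -/
theorem padicRowU_of_mem_atlasR2A11 {C : AtlasCurve} (hC : C ∈ atlasR2A11) {c : AtlasCell}
    (hc : c ∈ C.cells) [Fact c.p.Prime] [(C.e.baseChange ℚ).IsElliptic]
    [(C.e.baseChange ℚ).IsGloballyMinimal] (hPRS : Schneider1985_order_charGenerator) {N : ℕ}
    [NeZero N] {f : CuspForm (Gamma0 N) 2} (hf : IsNewformOf (C.e.baseChange ℚ) f)
    (hkato : ∀ (κ : ZpExtension ℚ c.p) (γ : Field.absoluteGaloisGroup ℚ),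
      kato_divisibility (C.e.baseChange ℚ) c.p (κ := κ) (γ := γ) (f := f))
    (D : ℚ) (hD : ‖(D : ℚ_[c.p])‖ = 1) (hint : ∀ x : ℚ, ‖(ratPlusSymbol f x : ℚ_[c.p])‖ ≤ 1)
    (htab : ∀ u : ℕ, u < c.p ^ (c.n + 1) → ¬ c.p ∣ u →
      ratPlusSymbol f ((u : ℚ) / (c.p : ℚ) ^ (c.n + 1)) = (c.tabHi.getD u 0 : ℚ) / D ∧
      ratPlusSymbol f ((u : ℚ) / (c.p : ℚ) ^ c.n) = (c.tabLo.getD (u % c.p ^ c.n) 0 : ℚ) / D) :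
    C.row.curve.mordellWeilRank = 2 ∧
      (padicLFunction f (unitRoot (C.e.baseChange ℚ) c.p : ℚ_[c.p])).order = 2 ∧
      Finite (AddCommGroup.primaryComponent (C.e.baseChange ℚ).sha c.p) ∧
      (∀ Dh : PAdicHeightData (C.e.baseChange ℚ) c.p, Dh.IsCanonical → SchneiderConjecture Dh) ∧
      (C.e.baseChange ℚ).selmerCorank c.p = 2 :=
  AtlasCurve.padicRow (AtlasCurve.check_of_all₂ atlasR2A11_check hC).1 hc hPRS hf hkato
    (two_le_rank_of_mem_atlasR2A11 hC) D hD hint htab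

end Summit.BirchSwinnertonDyer.BirchSwinnertonDyer.Rank2Observatory
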